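import Literature.Analysis.FluidPDE.LocalTypeILiouville
import HarnessLib

/-!
# Albritton–Barker's Type I quantity controls almost every time slice at EVERY centre:
# the uniformly local (Morrey) energy bound on a.e. slice

Analysis/FluidPDE support file (theorems only, everything PROVED; no definitions, no named facts,
no `sorry`), sibling of `LocalTypeILiouville.lean` (`ae_energy_ball_le_typeIBound`: the bound at the
ORIGIN).  D. Albritton, T. Barker, *On local Type I singularities of the Navier–Stokes equations and
Liouville theorems*, J. Math. Fluid Mech. **21** (2019) = arXiv:1811.00502, §1, the displays after
Thm 1.1: `A(Q') = esssup_{t−r²<t'<t} r⁻¹ ∫_{B(x,r)} |v(x',t')|² dx'` and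
`𝐈(ω) = sup_{Q' ⊂ ω} A(Q') + C(Q') + D(Q') + E(Q')` — so `𝐈(ω) ≤ M` bounds `A` on EVERY admissible
parabolic ball, i.e. the energy of almost every slice on every ball below the vertex, at the Morrey
rate `∫_{B(x,r)} |v(t')|² ≤ M r`.  Here this is made usable SIMULTANEOUSLY at all centres on a.e. slice
(the essential supremum in `A` produces one null set of times per ball; countably many balls with
centres in a dense set suffice, by the covering `B(z,ρ) ⊆ B(q,2ρ)`):

* `ae_energy_ball_le_typeIBound_at` — the tree's origin statement at an arbitrary vertex `(t₀, x)`
  with `Q((t₀,x), r) ⊆ ω`;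
* `parabolicCylinder_subset_apex` — `Q((0,x), r) ⊆ Q((0,0), |x| + r)`;
* `ae_forall_lintegral_ball_le_of_typeIBound_apex` — **main**: if `𝐈(Q((0,0), a)) ≤ M` for every
  `a > 0` (the Type-I clause of an apex package), then for every `ρ > 0`, for a.e. `t ∈ (−4ρ², 0)`,
  `∫_{B(z,ρ)} |u(t)|² ≤ 2ρ·M` for ALL centres `z` — the uniformly local energy of the slice at scale
  `ρ`, `‖u(t)‖²_{L²_{uloc,ρ}} ≤ 2ρM`, uniformly in `t`.

## Mathlib / tree search

Tree: `cknAEss`, `abScaledSum_le_typeIBound`, `typeIBound_mono`, `ae_energy_ball_le_typeIBound`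
(origin only), `mem_parabolicCylinder` (`LocalTypeI`, `LocalTypeILiouville`, `SuitableWeak`).  Mathlib:
`TopologicalSpace.exists_countable_dense`, `Dense.exists_dist_lt`, `ae_ball_iff`,
`ENNReal.ae_le_essSup`, `ENNReal.mul_inv_cancel`.  `lean search 'uloc.*typeIBound|forall.*ball.*typeIBound'`:
nothing beyond the origin version.  No new definitions, no instances, no notation.
-/

noncomputable section

open MeasureTheory Set Function Filter Topology Metric
open scoped NNReal ENNReal

namespace Literature.Analysis.FluidPDE

variable {u : ℝ → EuclideanSpace ℝ (Fin 3) → EuclideanSpace ℝ (Fin 3)}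
  {p : ℝ → EuclideanSpace ℝ (Fin 3) → ℝ}
  {G : ℝ → EuclideanSpace ℝ (Fin 3) → EuclideanSpace ℝ (Fin 3) →L[ℝ] EuclideanSpace ℝ (Fin 3)}
  {ω : Set (ℝ × EuclideanSpace ℝ (Fin 3))}

/-- **Almost every slice is controlled by `𝐈` on every admissible ball**: if `Q((t₀, x), r) ⊆ ω`,
`r > 0`, then for a.e. `t ∈ (t₀ − r², t₀)`, `r⁻¹ ∫_{B(x,r)} |u(t)|² ≤ A(Q((t₀,x),r)) ≤ 𝐈(ω)` (the
`esssup_t` in Albritton–Barker's `A` sees almost every slice).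
[cite: AlbrittonBarker2019, §1 after Thm 1.1 (the displays defining A and 𝐈(ω))] -/
theorem ae_energy_ball_le_typeIBound_at {r : ℝ} (hr : 0 < r) (t₀ : ℝ) (x : EuclideanSpace ℝ (Fin 3))
    (hω : FluidPDE.parabolicCylinder r (t₀, x) ⊆ ω) :
    ∀ᵐ t ∂(volume.restrict (Ioo (t₀ - r ^ 2) t₀)),
      (ENNReal.ofReal r)⁻¹ * ∫⁻ y in ball x r, ‖u t y‖ₑ ^ 2 ≤ typeIBound ω u p G := by
  have hA : cknAEss r (t₀, x) u ≤ typeIBound ω u p G :=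
    calc cknAEss r (t₀, x) u ≤ abScaledSum r (t₀, x) u p G :=
          le_add_right (le_add_right le_self_add)
      _ ≤ typeIBound ω u p G := abScaledSum_le_typeIBound hr hω
  filter_upwards [ENNReal.ae_le_essSup (μ := volume.restrict (Ioo (t₀ - r ^ 2) t₀))
    (fun t : ℝ => (ENNReal.ofReal r)⁻¹ * ∫⁻ y in ball x r, ‖u t y‖ₑ ^ 2)] with t ht
  exact ht.trans hA

/-- A parabolic ball with vertex on the top slice lies in an apex cylinder:
`Q((0,x), r) ⊆ Q((0,0), |x| + r)` for `r > 0`. [folklore] -/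
private theorem parabolicCylinder_subset_apex {r : ℝ} (hr : 0 < r) (x : EuclideanSpace ℝ (Fin 3)) :
    FluidPDE.parabolicCylinder r ((0 : ℝ), x) ⊆
      FluidPDE.parabolicCylinder (‖x‖ + r) (0 : ℝ × EuclideanSpace ℝ (Fin 3)) := by
  intro w hw
  obtain ⟨⟨h1, h2⟩, h3⟩ := FluidPDE.mem_parabolicCylinder.1 hw
  have hx0 : 0 ≤ ‖x‖ := norm_nonneg x
  refine FluidPDE.mem_parabolicCylinder.2 ⟨⟨?_, ?_⟩, ?_⟩
  · simp only [Prod.fst_zero]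
    have : r ^ 2 ≤ (‖x‖ + r) ^ 2 := by nlinarith
    simp only at h1
    linarith
  · simpa using h2
  · simp only [Prod.snd_zero]
    have h3' : dist w.2 x < r := h3
    calc dist w.2 0 ≤ dist w.2 x + dist x 0 := dist_triangle _ _ _
      _ < r + ‖x‖ := by rw [dist_zero_right]; linarith
      _ = ‖x‖ + r := add_comm _ _

/-- Covering step: a bound on the balls `B(q, 2ρ)`, `q` in a `ρ`-dense set, bounds every ball
`B(z, ρ) ⊆ B(q, 2ρ)`. [folklore] -/
private theorem forall_lintegral_ball_le_of_dense' {Q : Set (EuclideanSpace ℝ (Fin 3))} {ρ : ℝ}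
    (hQ : ∀ z : EuclideanSpace ℝ (Fin 3), ∃ q ∈ Q, dist z q < ρ)
    {g : EuclideanSpace ℝ (Fin 3) → ℝ≥0∞} {α : ℝ≥0∞}
    (hα : ∀ q ∈ Q, ∫⁻ y in ball q (2 * ρ), g y ≤ α) (z : EuclideanSpace ℝ (Fin 3)) :
    ∫⁻ y in ball z ρ, g y ≤ α := by
  obtain ⟨q, hq, hzq⟩ := hQ z
  refine (lintegral_mono_set fun y hy => ?_).trans (hα q hq)
  rw [mem_ball] at hy ⊢
  calc dist y q ≤ dist y z + dist z q := dist_triangle _ _ _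
    _ < ρ + ρ := add_lt_add hy hzq
    _ = 2 * ρ := by ring

/-- **The uniformly local energy of almost every slice, at every centre, from the Type-I clause of
an apex package.** If `𝐈(Q((0,0), a)) ≤ M` for every `a > 0`, then for every `ρ > 0`, for a.e.
`t ∈ (−4ρ², 0)`: `∫_{B(z,ρ)} |u(t)|² ≤ 2ρ · M` for ALL `z ∈ ℝ³` (Albritton–Barker's
`A(Q((0,q), 2ρ)) ≤ 𝐈` at the points `q` of a countable dense set, one null set of times each, and
`B(z,ρ) ⊆ B(q,2ρ)`). [cite: AlbrittonBarker2019, §1 after Thm 1.1 (the displays defining A and 𝐈(ω): 𝐈 bounds the scaled energy of every admissible parabolic ball)] -/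
theorem ae_forall_lintegral_ball_le_of_typeIBound_apex {M : ℝ≥0∞}
    (hI : ∀ a : ℝ, 0 < a →
      typeIBound (FluidPDE.parabolicCylinder a (0 : ℝ × EuclideanSpace ℝ (Fin 3))) u p G ≤ M)
    {ρ : ℝ} (hρ : 0 < ρ) :
    ∀ᵐ t ∂(volume.restrict (Ioo (-(2 * ρ) ^ 2) (0 : ℝ))),
      ∀ z : EuclideanSpace ℝ (Fin 3),
        ∫⁻ y in ball z ρ, ‖u t y‖ₑ ^ 2 ≤ ENNReal.ofReal (2 * ρ) * M := by
  obtain ⟨Q, hQc, hQd⟩ := TopologicalSpace.exists_countable_dense (EuclideanSpace ℝ (Fin 3))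
  have h2ρ : 0 < 2 * ρ := by linarith
  -- one null set of times per centre `q ∈ Q`
  have hq : ∀ q ∈ Q, ∀ᵐ t ∂(volume.restrict (Ioo (-(2 * ρ) ^ 2) (0 : ℝ))),
      ∫⁻ y in ball q (2 * ρ), ‖u t y‖ₑ ^ 2 ≤ ENNReal.ofReal (2 * ρ) * M := by
    intro q _
    have hsub := parabolicCylinder_subset_apex h2ρ q
    have hIq : typeIBound (FluidPDE.parabolicCylinder (2 * ρ) ((0 : ℝ), q)) u p G ≤ M :=
      (typeIBound_mono hsub).trans (hI _ (by positivity))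
    have h := ae_energy_ball_le_typeIBound_at (u := u) (p := p) (G := G) h2ρ 0 q subset_rfl
    rw [zero_sub] at h
    filter_upwards [h] with t ht
    have hne0 : ENNReal.ofReal (2 * ρ) ≠ 0 := by
      rw [ne_eq, ENNReal.ofReal_eq_zero, not_le]; exact h2ρ
    calc ∫⁻ y in ball q (2 * ρ), ‖u t y‖ₑ ^ 2
        = ENNReal.ofReal (2 * ρ) *
            ((ENNReal.ofReal (2 * ρ))⁻¹ * ∫⁻ y in ball q (2 * ρ), ‖u t y‖ₑ ^ 2) := by
          rw [← mul_assoc, ENNReal.mul_inv_cancel hne0 ENNReal.ofReal_ne_top, one_mul]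
      _ ≤ ENNReal.ofReal (2 * ρ) * M := mul_le_mul' le_rfl (ht.trans hIq)
  have hall : ∀ᵐ t ∂(volume.restrict (Ioo (-(2 * ρ) ^ 2) (0 : ℝ))), ∀ q ∈ Q,
      ∫⁻ y in ball q (2 * ρ), ‖u t y‖ₑ ^ 2 ≤ ENNReal.ofReal (2 * ρ) * M :=
    (ae_ball_iff hQc).2 hq
  filter_upwards [hall] with t ht
  exact forall_lintegral_ball_le_of_dense' (fun z => hQd.exists_dist_lt z hρ) ht

end Literature.Analysis.FluidPDE

end
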